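import Summits.AtomisticToContinuum.Crystallization.Theses.PalmUnimodularRigidity
import Summits.AtomisticToContinuum.Crystallization.Theorems.MinimiserShells.Negative.LoadBearing
import Summits.AtomisticToContinuum.Crystallization.Theorems.PalmUnimodularRigidityMinimiserShellsEquilibriumInLaw
import Summits.AtomisticToContinuum.Crystallization.Theorems.PalmUnimodularRigidityMinimiserShellsEnergyFloor
import Summits.AtomisticToContinuum.Crystallization.Theorems.PalmUnimodularRigidityMinimiserShellsMuGSCBasics
import Summits.AtomisticToContinuum.Crystallization.Theorems.PalmUnimodularRigidityCruxesToPalmRigidity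
import Literature.Probability.Process.PointStationaryLaw
import Literature.MathematicalPhysics.StatisticalMechanics.RootEnergy
import Literature.MathematicalPhysics.StatisticalMechanics.MuGSC

/-!
# Line `defect-exchange-two-resolutions` — checked skeleton for crux `MinimiserShells`
(item stmt-AtomisticToContinuum-9225, route `PalmUnimodularRigidity`, rank 2; crux-plan of the round-2 idea card
`Cruxes/MinimiserShells/Ideas/defect-exchange-two-resolutions.md`, triage TRIAGE-r2-1 / TRIAGE-r2-2: pass, "plan ONE
line A{(D) := B's rows, fine step := C}")

Crux (BY NAME; `minimiserShells_iff` of `Negative.LoadBearing` is `Iff.rfl`): every minimising (`E_P[h] ≤ e*`)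
point-stationary `δ`-hard-core probability law on rooted configurations of `ℝ³` has, almost surely, an
`(a/100)`-close-packed root shell (`GoodShell`).

## The line

LEVER (card A): the DEFECT EXCHANGE IDENTITY — the Mecke identity with the allocation kernel "the root sends its
whole settled account to its nearest AWFUL site(s)" (`DefectExchange`, PROVED below: `defectExchange_holds`).  With
`f = (h − e* + net transfer)^±` the exact balance `E_P[h] = e*` of a minimising law (9229, in tree) becomes: the
typical awful site's CELL ACCOUNT has zero expectation, so a DETERMINISTIC per-defect solvency statement
("every awful site's cell account is `≥ c > 0`") forces `P(root awful) = 0` — no density parameter, no slack budget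
(Disproof §4: no slack version can hold), the transfer term compulsory (§2c) and genuinely re-rooting of unbounded
range through the cells (§2b, §6c, §9).

FRAME (what the tree already gives, used in the composition, no stub): a minimising point-stationary hard-core law is
a.s. carried by Sütő `e*`-`μ`GSCs of Lennard-Jones (`EquilibriumInLaw.stub_equilibriumInLaw`, LANDED p97236, with
`EnergyFloor.stub_energyFloor` = item 9229, LANDED) — so every deterministic statement of this line lives on the class
`InClass` of rooted, `17/20`-separated `e*`-`μ`GSCs: no far comb (§9), no lone cluster (§11), force balance for free
(`tube_muGSC_forceBalance`, LANDED: card C's `ForceBalanceAS` is not a stub any more), hard core `1/3` for free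
(`VolumeGrowth.Basics.le_dist`).

TWO RESOLUTIONS.  Awful := root shell not `(a/20)`-good (`¬ CoarseGood`).  Sites are classified POINTWISE at one
mesoscopic radius `R = 4`: DENSE-type (at least half of the configuration points of `B̄(x, 4)` are awful) or
SPARSE-type.  The cell account of an awful site `b` is `Σ_x share(x → b)·(h_x − e* + net t_D(x) + net t_S(x))` over the
sites `x` whose nearest awful sites include `b` (ties shared equally), with two independent bounded finite-range
transfers: `t_D` (sourced at dense-type awful roots) and `t_S` (sourced at sparse-type awful roots).  Additivity of the
ledger makes the two certificates INDEPENDENT stubs with no shared witness: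

* `stub_muGSCHardCore` (S1, triage r2-1/r2-2 "first stub"): every uniformly discrete `e*`-`μ`GSC of LJ is
  `17/20`-separated (the tree has `1/3`).
* `stub_denseSolvency` (S2 = certificate (D), card B's cap rows + the Bain / near-affine rows of TRIAGE-r2-1):
  POINTWISE after the transfer `t_D`, a dense-type awful root has account `h − e* + net t_D ≥ c_D` (ceiling
  `c_D ≤ 8.4e-3 = 1.17 %·|e*|`, the 3.4 %-tetragonal fcc Palm law, kit j020414 — NOT 4.6 %), a dense-type good root
  `≥ 0` exactly (its slack is routed inside `t_D` from the ≥ 50 % awful sites of its 4-ball, the card's load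
  argument), a sparse-type awful root is drained by at most `drainCap = 1/250 = 2·s_D`, and sparse good roots send
  nothing.  A FINITE-RANGE statement up to the density tail bound `C·R⁻³` of `h`: energy-Flyspeck at percent
  resolution on `B̄(0, 4 + range)`-patterns.
* `stub_sparseSolvency` (S3 = certificate (S) + LeakSummability, HARDEST): in CELL form — the sparse-territory
  part `Σ_x share(x → b)·(h_x − e* + net t_S(x))·1[x sparse]` of every awful site's cell is self-financing, with
  margin `drainCap + c_S` when the cell's root `b` is itself sparse-type; `t_S` (never sourced at dense sites)
  carries the hcp sublattice PAIRING (TRIAGE-r2-2: linear strain-gradient coupling `±0.1456` alternating by layer),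
  so the sitewise-combined account has a summable negative part.  Its domain is EVERY ball with `< 50 %` awful sites
  (r2-2: one wrong layer in seven is all-sparse), not only isolated defects in a visible matrix.
* `stub_exchangeGlue` (S4, measure theory + ledger): 9229 + (D) + (S) ⇒ a minimising law a.s. carried by
  `InClass` configurations has an a.s. COARSE-good root (exchange identity for `a^±`,
  `a = h − e* + net t_D + net t_S`; integrability `E a⁺ = E a⁻ < ∞` ⇒ cell deficits a.s. finite; dense sites of a
  cell lie within `4` of its root and `t_D`-terms within `4 + range`, so (D) pointwise + (S) in cell form give
  `A⁺ ≥ A⁻ + min(c_D, c_S)` at every awful root; conditioning on the re-rooting-invariant event {no awful site}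
  via Disproof §7b).
* `stub_fineEndgame` (S5 = card C's fine step, tolerance ladder `a/20 → a/100`): a minimising law a.s. carried by
  `InClass` configurations ALL of whose points are coarse-good has `(a/100)`-good root shells a.s. — priced relative
  to `e_B := inf_s e(Barlow s) ≥ e*` (every Hägg word periodises to energy `≥ e*` by definition of `e*`), so no
  stacking selection and no knowledge of `e*` enter; force balance and one-particle optimality come from `IsMuGSC`.

`MinimiserShells_of : MinimiserShells` — real proof: crux hypotheses ⇒ a.s. `e*`-`μ`GSC (tree) ⇒ S1 ⇒ a.s. `InClass`
⇒ S4 fed with the witnesses of S2, S3 ⇒ a.s. coarse-good ROOT ⇒ every point coarse-good a.s.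
(`PalmUnimodularRigidity.ae_forall_map_sub_of_ae`, tree) ⇒ S5.  `minimiserShells_of_stubs` is the same with the five
stub STATEMENTS as hypotheses (clean axiom closure).

WHAT THIS LINE DOES NOT HIDE (TRIAGE-r2-1/2, PICKED.md c9): (D) ∧ (S) ∧ S4 give "minimising ⇒ a.s. coarse-good
root", whose periodic shadow is the COARSE shell gap (`PricingContainment`, p127485; `Residual.minimiserShells_sandwich`,
p121752/p123347): S2/S3 are crux-class by certificate, the card concedes it ("(D) is Flyspeck-for-LJ at percent
resolution; (S) is the qualitative statement to prove").  What the line adds is SHAPE: a per-defect, slack-free,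
two-resolution decomposition of that statement on the DLR class, with the exact glue proved.

## Disproof.lean obstructions honoured (tree `Cruxes/MinimiserShells/Disproof.lean`, gen 1–3, read 2026-08-16)
* §2a `minimiserShells_false_without_energy`: `E_P[h] ≤ e*` is a hypothesis of S4 and S5 and is USED (`E f = 0`).
* §2b `…_without_stationarity`, §6c `…_withReflectionOnly`, §9 `…_withLocalMecke`: S4 re-roots GENUINELY (the
  allocation kernel depends on `θ_y μ`) and with UNBOUNDED range (cells are Voronoi cells of the awful set); the far
  comb is not an `e*`-`μ`GSC and not `17/20`-separated — it is outside `InClass` (S1 + `stub_equilibriumInLaw`).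
* §2c `not_pointwiseMinimiserShells`: no stub is a transfer-free pointwise certificate; (D)/(S) carry transfers AND
  cell aggregation.
* §3 `minimiserShells_imp_unimodularEnergyLowerBound`: 9229 is an explicit hypothesis of S4 (discharged in the
  composition by the landed `EnergyFloor.stub_energyFloor`).
* §4/§4b `not_minimiserShellsSlack`: nothing is stable under `E ↦ E + s`; exact minimality enters through `E f = 0`.
* §5/§8 `linearPricing_ceiling(_partial)`: the FINE predicate is never priced (S5 is relative to `e_B`); the coarse
  margin is budgeted at `8.4e-3` (r2-1 N1), not at the TCP margins.
* §6a/§6b: `IsProbabilityMeasure` and unit atom masses (`μ = count|S`) are kept in every stub.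
* §11 finite clusters: excluded by `IsMuGSC` (`VolumeGrowth.Basics.not_isMuGSC_singleton`-type tests), not assumed.
* Landed `Theorems/MinimiserShells/Negative/*`: no stub is pointwise, slack, finite-range-Mecke, unnormalised,
  mult-rooted or reflection-only.  Negative 4146 (D5h soft shell): a D5h centre is awful and SPARSE-type in any
  extended configuration, priced by (S) relative to its visible fcc wedges, never by a kissing inference.
-/

noncomputable section

open MeasureTheory
open scoped ENNReal BigOperators Classical

namespace Summit.AtomisticToContinuum.Crystallization.Cruxes.MinimiserShells.DefectExchangeTwoResolutions

open Literature.Probability.Process (IsPointStationaryLaw IsRootedHardCore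
  count_restrict_singleton_ne_zero_iff map_sub_count_restrict)
open Literature.MathematicalPhysics.StatisticalMechanics (lennardJones IsMuGSC UniformlyDiscrete)
open Literature.Geometry.DiscreteGeometry (ShellCloseTo fccKissingPattern hcpKissingPattern)
open Summit.AtomisticToContinuum.Crystallization.Theses.PalmUnimodularRigidity
  (MinimiserShells UnimodularEnergyLowerBound)
open Summit.AtomisticToContinuum.Crystallization.Theorems.MinimiserShells.Negative.LoadBearing
  (eStar meanRootEnergy GoodShell minimiserShells_iff)
open Summit.AtomisticToContinuum.Crystallization.Theorems.PalmUnimodularRigidity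
  (ae_forall_map_sub_of_ae count_restrict_floorNorm_preimage_lt_top)

/-- Euclidean 3-space. -/
abbrev E3 := EuclideanSpace ℝ (Fin 3)

/-! ## Vocabulary of the line -/

/-- **Coarse-good root shell** (tolerance `a/20`; "awful" := not coarse-good): the crux's predicate
`GoodShell` with `a/100` replaced by `a/20`. -/
def CoarseGood (μ : Measure E3) : Prop :=
  ∃ a : ℝ, 9 / 10 ≤ a ∧ a ≤ 1 ∧ ∃ T : Finset E3,
    (↑T : Set E3) = {y : E3 | μ {y} ≠ 0 ∧ y ≠ 0 ∧ ‖y‖ ≤ 5 / 4 * a} ∧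
    (ShellCloseTo (a / 20) T (Finset.image (fun v : E3 => a • v) fccKissingPattern) ∨
      ShellCloseTo (a / 20) T (Finset.image (fun v : E3 => a • v) hcpKissingPattern))

/-- The configuration `S` seen from the point `x`: `count|(S − x)` (`= θ_x (count|S)`,
`map_sub_count_restrict`). -/
def reroot (S : Set E3) (x : E3) : Measure E3 :=
  (Measure.count : Measure E3).restrict ((fun z => z - x) '' S)

/-- Site energy `h_x = ½ Σ_{y ∈ S} V_LJ(|y − x|)` (the route's inlined Bochner term at the re-rooted
configuration). -/
def siteEnergy (S : Set E3) (x : E3) : ℝ := (∫ y, lennardJones ‖y‖ ∂(reroot S x)) / 2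

/-- The AWFUL set of `S`: sites whose shell is not `(a/20)`-good. -/
def awfulSet (S : Set E3) : Set E3 := {x ∈ S | ¬ CoarseGood (reroot S x)}

/-- **Dense-type** site at the mesoscopic radius `R = 4` (threshold `1/2`): at least half of the
configuration points of `B̄(x, 4)` are awful.  Sparse-type := not dense-type.  (`ncard`: the sets are
finite on the hard-core class.) -/
def IsDense (S : Set E3) (x : E3) : Prop :=
  ((S ∩ Metric.closedBall x 4).ncard : ℝ) ≤ 2 * ((awfulSet S ∩ Metric.closedBall x 4).ncard : ℝ)

/-- The nearest awful sites of `x` (all awful sites at minimal distance; empty iff there is no awful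
site, finite and non-empty otherwise on the hard-core class). -/
def nearestAwful (S : Set E3) (x : E3) : Set E3 :=
  {b ∈ awfulSet S | ∀ b' ∈ awfulSet S, dist x b ≤ dist x b'}

/-- **Allocation share** `share S x b`: the site `x` sends the fraction `1/#nearestAwful` of its account
to each of its nearest awful sites `b` (the Mecke kernel of the exchange identity; no tie-break). -/
def share (S : Set E3) (x b : E3) : ℝ :=
  if b ∈ nearestAwful S x then ((nearestAwful S x).ncard : ℝ)⁻¹ else 0

/-- **Admissible transfer**: `t ν y ≥ 0` = amount the root of the rooted configuration `ν` SENDS to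
its point `y`; jointly measurable, non-negative, bounded, of finite range. -/
def IsTransfer (t : Measure E3 → E3 → ℝ) : Prop :=
  Measurable (Function.uncurry t) ∧ (∀ ν y, 0 ≤ t ν y) ∧ (∃ M : ℝ, ∀ ν y, t ν y ≤ M) ∧
    ∃ R : ℝ, ∀ ν y, R < ‖y‖ → t ν y = 0

/-- Net transfer RECEIVED by the site `x` of `S` under `t`: `Σ_{z ∈ S} (t(θ_z, x − z) − t(θ_x, z − x))`
(a finite sum for admissible `t` on the hard-core class; its expectation at the root of a
point-stationary law vanishes by the Mecke identity). -/
def netTransfer (t : Measure E3 → E3 → ℝ) (S : Set E3) (x : E3) : ℝ :=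
  ∫ y, (t ((reroot S x).map (fun z => z - y)) (-y) - t (reroot S x) y) ∂(reroot S x)

/-- **Drain cap** `1/250 = 4e-3`: the most the dense certificate's transfer may take, net, from a
SPARSE-type awful site (the card's load bound "each awful site receives ≤ 2·s_D", `s_D ≤ c_D/4 ≈ 2e-3`,
TRIAGE-r2-2); the sparse certificate must clear it.  The one numeral coupling the two certificates. -/
def drainCap : ℝ := 1 / 250

/-- **The deterministic class of the line**: rooted, `17/20`-separated Sütő `e*`-`μ`GSCs of
Lennard-Jones (minimising laws are a.s. carried by it: `stub_equilibriumInLaw` + `stub_muGSCHardCore`). -/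
def InClass (S : Set E3) : Prop :=
  (0 : E3) ∈ S ∧ (∀ x ∈ S, ∀ y ∈ S, x ≠ y → (17 / 20 : ℝ) ≤ dist x y) ∧ IsMuGSC lennardJones eStar S

/-- **Certificate (D) — DENSE PRICING with margin `c` and transfer `t`** (pointwise at the root, after
transfer; a FINITE-RANGE statement).  For every configuration of the class: (i) a dense-type AWFUL root
has account `h − e* + net t ≥ c`; (ii) a dense-type coarse-good root has account `≥ 0` EXACTLY (the
certificate's residual slack at such sites is routed INSIDE `t` from the awful sites of the root's
`4`-ball — at least half of that ball); (iii) a sparse-type awful root is drained by at most `drainCap`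
net; (iv) a sparse-type coarse-good root sends nothing under `t`. -/
def DensePricing (c : ℝ) (t : Measure E3 → E3 → ℝ) : Prop :=
  ∀ S : Set E3, InClass S →
    ((0 : E3) ∈ awfulSet S → IsDense S 0 → c ≤ siteEnergy S 0 - eStar + netTransfer t S 0) ∧
    ((0 : E3) ∉ awfulSet S → IsDense S 0 → 0 ≤ siteEnergy S 0 - eStar + netTransfer t S 0) ∧
    ((0 : E3) ∈ awfulSet S → ¬ IsDense S 0 → -drainCap ≤ netTransfer t S 0) ∧
    ((0 : E3) ∉ awfulSet S → ¬ IsDense S 0 → ∀ y : E3, t (reroot S 0) y = 0)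

/-- Sparse-territory account of the site `x` under the sparse transfer `t`:
`h_x − e* + net t(x)` at SPARSE-type sites, `0` at dense-type sites. -/
def sparseAcc (t : Measure E3 → E3 → ℝ) (S : Set E3) (x : E3) : ℝ :=
  if IsDense S x then 0 else siteEnergy S x - eStar + netTransfer t S x

/-- Income of the ROOT's cell from sparse territory: `Σ_x share(x → 0)·(sparseAcc x)⁺` over the sites
of `S` (an `ℝ≥0∞`-valued sum over the possibly infinite cell of the root `0`). -/
def sparsePos (t : Measure E3 → E3 → ℝ) (S : Set E3) : ℝ≥0∞ :=
  ∑' x : S, ENNReal.ofReal (share S x 0 * sparseAcc t S x)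

/-- Deficit of the root's cell in sparse territory: `Σ_x share(x → 0)·(sparseAcc x)⁻`. -/
def sparseNeg (t : Measure E3 → E3 → ℝ) (S : Set E3) : ℝ≥0∞ :=
  ∑' x : S, ENNReal.ofReal (-(share S x 0 * sparseAcc t S x))

/-- **Certificate (S) — SPARSE SOLVENCY with margin `drainCap + c` and transfer `t`** (cell form;
leak summability included).  `t` is never sourced at dense-type sites; and for every configuration of
the class whose root is AWFUL and whose sparse-territory cell deficit is finite: if the root is
sparse-type, the sparse part of its cell (which contains the root) is solvent with margin
`drainCap + c`; if the root is dense-type, the sparse part of its cell (e.g. the good exterior region a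
blob-boundary site owns) is self-financing. -/
def SparseSolvent (c : ℝ) (t : Measure E3 → E3 → ℝ) : Prop :=
  (∀ S : Set E3, InClass S → IsDense S 0 → ∀ y : E3, t (reroot S 0) y = 0) ∧
  ∀ S : Set E3, InClass S → (0 : E3) ∈ awfulSet S → sparseNeg t S ≠ ⊤ →
    (¬ IsDense S 0 → ENNReal.ofReal (drainCap + c) + sparseNeg t S ≤ sparsePos t S) ∧
    (IsDense S 0 → sparseNeg t S ≤ sparsePos t S)

/-! ## The lever, proved: the defect exchange identity -/

/-- **Defect exchange (Mecke form).**  For a point-stationary law `P`, a measurable `f ≥ 0` and a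
measurable allocation `τ` (the root sends its whole mass `f μ` to the configuration point `τ μ`, an
atom of mass `1`), the expectation of `f` at the root equals the expectation of the total mass
RECEIVED by the root: the sum of `f (θ_y μ)` over the points `y` whose allocation, seen from `y`, is
the old root `-y`.  (S4 uses the fractional version — kernel `share`; same proof with
`g μ y = share(μ, y)·f μ`.) -/
def DefectExchange : Prop :=
  ∀ P : Measure (Measure E3), IsPointStationaryLaw P →
    ∀ f : Measure E3 → ℝ≥0∞, Measurable f →
    ∀ τ : Measure E3 → E3, Measurable τ → (∀ᵐ μ ∂P, μ {τ μ} = 1) →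
      ∫⁻ μ, f μ ∂P =
        ∫⁻ μ, ∫⁻ y, Set.indicator {y' : E3 | τ (Measure.map (fun z => z - y') μ) = -y'}
          (fun y' => f (Measure.map (fun z => z - y') μ)) y ∂μ ∂P

/-- `DefectExchange` holds: it is the Mecke identity applied to `g μ y := 1{τ μ = y} · f μ`
(card A's first lemma, `IdeatorFourSketch.defectExchange_holds`, re-proved here so the line file is
self-contained). [folklore] -/
theorem defectExchange_holds : DefectExchange := by
  intro P hP f hf τ hτ hatom
  set g : Measure E3 → E3 → ℝ≥0∞ := fun μ y => Set.indicator {y' : E3 | τ μ = y'} (fun _ => f μ) y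
    with hg_def
  have hg : Measurable (Function.uncurry g) := by
    have hset : MeasurableSet {p : Measure E3 × E3 | τ p.1 = p.2} :=
      measurableSet_eq_fun (hτ.comp measurable_fst) measurable_snd
    have : Function.uncurry g = Set.indicator {p : Measure E3 × E3 | τ p.1 = p.2}
        (fun p => f p.1) := by
      funext p
      rcases p with ⟨μ, y⟩
      simp only [Function.uncurry_apply_pair, hg_def, Set.indicator_apply, Set.mem_setOf_eq]
    rw [this]
    exact (hf.comp measurable_fst).indicator hset
  have hmecke := hP g hg
  have hleft : ∫⁻ μ, ∫⁻ y, g μ y ∂μ ∂P = ∫⁻ μ, f μ ∂P := by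
    refine lintegral_congr_ae (hatom.mono fun μ hμ => ?_)
    have hs : ({y' : E3 | τ μ = y'} : Set E3) = {τ μ} := by
      ext y'; simp [eq_comm]
    simp only [hg_def, hs]
    rw [lintegral_indicator (measurableSet_singleton _), setLIntegral_const, hμ, mul_one]
  have hright : ∫⁻ μ, ∫⁻ y, g (Measure.map (fun z => z - y) μ) (-y) ∂μ ∂P =
      ∫⁻ μ, ∫⁻ y, Set.indicator {y' : E3 | τ (Measure.map (fun z => z - y') μ) = -y'}
          (fun y' => f (Measure.map (fun z => z - y') μ)) y ∂μ ∂P := by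
    refine lintegral_congr (fun μ => lintegral_congr (fun y => ?_))
    simp only [hg_def, Set.indicator_apply, Set.mem_setOf_eq]
  rw [← hleft, hmecke, hright]

/-! ## The five registered stubs -/

/-- **STUB S1 — hard core of `e*`-`μ`GSCs (the minimal-distance lemma; triage: "first stub").**
Every uniformly discrete Sütő `e*`-`μ`GSC of Lennard-Jones in `ℝ³` is `17/20`-separated.  In tree:
`1/3` (`VolumeGrowth.Basics.le_dist`, evaporation test `Σ_{y≠x} V(|x−y|) ≤ e*` + shell sum); `≈ 0.7`
follows the same way with a kissing-type count; the last step to `0.85` needs the one-particle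
re-insertion test (`x` minimises the field of `S ∖ {x}` globally, `IsMuGSC.exchange` with `n = k = 1`)
and/or two-particle removal.  Why it might fail: an `e*`-`μ`GSC with a locally stable compressed pair
(split-interstitial geometry, bond ≈ 0.8) bound by more than `|e*|` — believed impossible (interstitial
formation energy `> 0`, removable by the (2 → 1) test), but the margin is numeric. -/
theorem stub_muGSCHardCore :
    ∀ S : Set E3, UniformlyDiscrete S → IsMuGSC lennardJones eStar S →
      ∀ x ∈ S, ∀ y ∈ S, x ≠ y → (17 / 20 : ℝ) ≤ dist x y := by
  sorry

/-- **STUB S2 — certificate (D): DENSE PRICING** (coarse bulk certificate at percent resolution; the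
card's (D) with card B's cap rows and r2-1's near-affine / Bain rows as its row families).  There are a
margin `c_D > 0` and an admissible transfer `t_D` such that `DensePricing c_D t_D`: in every rooted
`17/20`-separated `e*`-`μ`GSC, POINTWISE at the root after the transfer, a DENSE-type awful root (at
least half of `B̄(0,4)` awful) has `h − e* + net t_D ≥ c_D`, a dense-type coarse-good root has `≥ 0`
exactly (its residual slack is routed inside `t_D` from the awful sites of its 4-ball — at least half
of the ball, so each awful site carries `≤ 2 s_D`, the card's load argument), a sparse-type awful root
is drained by at most `drainCap`, and a sparse-type good root sends nothing.  Up to the density tail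
bound `|h − h_{≤R}| ≤ C·R⁻³` the root's account reads only `B̄(0, 4 + range(t_D))`, so this is a FINITE
statement over ball patterns of the class: an energy-Flyspeck at percent resolution.  Budget (r2-1 N1, r2-2): binding family = homogeneously strained close packings just past
the `a/20` threshold (3.4 % tetragonal fcc: `8.4e-3 = 1.17 %·|e*|`, all sites awful, dense, capped,
topologically perfect; vertex-transitive so `net t ≡ 0`), hence `c_D ≤ 8.4e-3` and certificate radius
`3.4–4.8 a` (250–600 atoms); TCP rows (A15 +12 %, relaxed σ +7.85 % min site +3.9 %, C15 +18 %, bcc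
+4.3 %) are far inside.  Reference trick: every bound is a LOWER bound on `h − e*`, so `e*` may be
replaced by any certified periodic energy `e(Q₀) ≥ e*`.  Why it might fail: an insolvent dense
environment — a polytetrahedral / Frank–Kasper / amorphous ball whose awful sites sit below `e(Q₀)`
by more than their neighbours' transferable surplus within finite range (none known: j007481/j020414
found no insolvent TCP site), or `c_D` not uniform down to the awful threshold; or a dense-type GOOD
site with an onion-like over-dense outer ball (deficit up to ≈ 3e-2 below `e_hcp`) whose 4-ball's
awful sites are all sparse-type, so that the drain cap binds. -/
theorem stub_denseSolvency :
    ∃ c : ℝ, 0 < c ∧ ∃ t : Measure E3 → E3 → ℝ, IsTransfer t ∧ DensePricing c t := by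
  sorry

/-- **STUB S3 — certificate (S): SPARSE SOLVENCY with leak summability (HARDEST).**  There are
`c_S > 0` and an admissible transfer `t_S`, never sourced at dense-type sites, such that
`SparseSolvent c_S t_S`: in every rooted `17/20`-separated `e*`-`μ`GSC whose root `0` is AWFUL and
whose sparse-territory cell deficit `Σ_x share(x → 0)·(sparseAcc x)⁻` is finite, the sparse part of
the root's cell is solvent — with margin `drainCap + c_S` if the root is SPARSE-type (fewer than half
of `B̄(0,4)` awful; the root's own surplus is in the sum), self-financing if the root is dense-type
(a blob-boundary site owning a good exterior cone).  Content: (i) matrix-relative pricing of sparse defects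
— walls, dislocation / disclination cores, D5h wires (negative 4146: sparse-type, priced against its
five visible fcc wedges), stacking-fault edges — by compactness of `R`-ball configurations of the class
plus STRICT positivity of each defect's account ("no zero-cost sparse defect inside a Barlow matrix");
point-defect clusters are already excluded by `IsMuGSC` (finite modifications); (ii) LEAK SUMMABILITY
over the (possibly infinite) cell: at coarse-good sites `h_x − e* ≥ h_x − e(s_x) ≥ −leak(x)` with the
LOCAL Hägg word `s_x` as reference (`e(s) ≥ e*` by definition of `e*`: stacking-blind, no `J_k` signs,
decoupled from crux 9226), far field `≤ C·D⁻⁴` by density, the hcp strain-GRADIENT term (`±0.1456|∇ε|`,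
alternating by layer, r2-2) PAIRED by a bounded c-axis component of `t_S` so the residual is
`O(∇²ε) ∼ D⁻⁵`, summable; (iii) across walls the INTERFACE LATTICE-SUM LEMMA (two equal-scale Barlow
half-spaces: cross-interface `r⁻⁶` energy = reference ± `c_ℓ ≪ 1e-2` per interface site beyond three
layers, Poisson summation) replaces density-only leak bounds (0.3–1.2 per wall site, unaffordable).
Why it might fail: the DOMAIN is every `< 50 %`-awful 4-ball, not only isolated defects in a visible
matrix (r2-2: one wrong close-packed layer in seven is all-sparse with no perturbative ball) — a
sparse-type family with accounts `→ 0`, or a non-summable leak (unpaired gradient terms), kills it; and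
by `PricingContainment` (p127485) (D) ∧ (S) contain the coarse periodic shell gap. -/
theorem stub_sparseSolvency :
    ∃ c : ℝ, 0 < c ∧ ∃ t : Measure E3 → E3 → ℝ, IsTransfer t ∧ SparseSolvent c t := by
  sorry

/-- **STUB S4 — the exchange glue (measure theory).**  Given `e_uni ≥ e*` (item 9229, in tree), a dense
certificate and a sparse certificate, every minimising point-stationary probability law a.s. carried by
rooted `17/20`-separated `e*`-`μ`GSCs has an a.s. COARSE-good root.  Proof route: with
`a(x) = h_x − e* + net t_D(x) + net t_S(x)` and the fractional allocation kernel
`g(μ, y) = share(root → y)·a^±(μ)`, the exchange identity (`defectExchange_holds`, fractional form) gives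
`E[a^±(root)] = E[1{root awful}·A^±]`, `A^± = Σ_x share(x → root)·a(x)^±` (`ℝ≥0∞` sums over the cell,
as `sparsePos`/`sparseNeg` but with the full account); Mecke
kills `E[net t]` (bounded, finite range, hard core), 9229 and `E_P[h] ≤ e*` give `E a⁺ = E a⁻ < ∞`, so
`A⁻ < ∞` a.s. on {root awful}.  LEDGER: an awful site other than the root has share `0` (it is its own
nearest awful site); a dense-type site of the cell lies within `4` of the root, and a site receiving under
`t_D` lies within `4 + range(t_D)` of the root (senders under `t_D` are dense-type or awful, and the root
is among the receiver's nearest awful sites), so the `t_D`-terms of the cell form a FINITE sum, while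
`t_S` is combined sitewise into `sparseAcc`; dense sites have account `≥ c_D·1[root] ≥ 0` by (D)(i),(ii)
and the support clause of (S); sparse sites have `a = sparseAcc + net t_D ≥ sparseAcc − drainCap·1[root]`
by (D)(iii),(iv); hence `sparseNeg ≤ A⁻ + (finite) < ∞` and (S) applies, and summing the pointwise
identities with the shares gives
`A⁺ ≥ A⁻ + min(c_D, c_S)` at every awful root, so `min(c_D,c_S)·P(root awful) ≤ E[1_awful (A⁺ − A⁻)] = 0`.
The event {no awful site at all} is re-rooting invariant; on it the law conditioned (Disproof §7b
`meanRootEnergy_cond_le_of_minimising`, `isPointStationaryLaw_restrict`) is still minimising and the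
root is trivially not awful.  Lean costs: measurability of `CoarseGood` on the class
(`GoodShellMeasurable` pattern at `a/20`), of `share` and of `netTransfer` (s-finite kernel device of
`CruxesToPalmRigidity`).  Why it might fail: only through a mis-typed ledger (it is bookkeeping over two
exact identities); the risk of the LINE sits in S2/S3. -/
theorem stub_exchangeGlue :
    UnimodularEnergyLowerBound →
    ∀ (cD cS : ℝ) (tD tS : Measure E3 → E3 → ℝ), 0 < cD → 0 < cS →
      IsTransfer tD → IsTransfer tS → DensePricing cD tD → SparseSolvent cS tS →
      ∀ P : Measure (Measure E3), IsProbabilityMeasure P →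
        (∀ᵐ μ ∂P, ∃ S : Set E3, InClass S ∧ μ = (Measure.count : Measure E3).restrict S) →
        IsPointStationaryLaw P → meanRootEnergy P ≤ eStar →
        ∀ᵐ μ ∂P, CoarseGood μ := by
  sorry

/-- **STUB S5 — the fine endgame `a/20 → a/100` (card C's step; tube rigidity relative to `e_B`).**
A minimising point-stationary probability law a.s. carried by rooted `17/20`-separated `e*`-`μ`GSCs ALL
of whose points have coarse-good shells has `(a/100)`-good root shells almost surely.  Mechanism:
everywhere-coarse-good ⇒ local Barlow charts (robust layer theorem at `a/20`, cf. crux 9227 proved at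
`a/100`); `IsMuGSC` ⇒ force balance (`tube_muGSC_forceBalance`, tree) and one-particle optimality, so
interior regularity localises sub-threshold badness (card C, two-radius form of TRIAGE-r2-2: a bad but
coarse-good site is near-affine on an `R₂`-ball — there are no awful sites); energy
`E_P[h] ≥ E_P[e(s_root)] + κ·E_P[dist²(∇u(root), SO(3)·F*)] − (null-Lagrangian terms, zero by Mecke)`
with `e(s) ≥ e*` for EVERY Hägg word, so minimality forces `dist = 0` a.s. and shells `≈ 1e-4·a` from
ideal.  Relative to `e_B = inf_s e(s) ≥ e*`: if `e* < e_B` the hypothesis is vacuous, if `e* = e_B` it is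
elastic rigidity — NOT the crystal problem (no universal lower bound over all periodic `Q` is needed).
Why it might fail: coercivity must hold over the WHOLE `a/20` tube (bonds up to `1.10 r₀`, `V″` down
97 %, hydrostatic spinodal at `1.109 a*`, r2-2) or the rigidity constant degenerates; the hcp linear
strain-gradient coupling forces layer-paired bookkeeping; a Barlow polytype elastically soft inside the
tube, or an everywhere-coarse-good non-layered Delone set (9227's risk at 5× slack), refutes it. -/
theorem stub_fineEndgame :
    ∀ P : Measure (Measure E3), IsProbabilityMeasure P →
      (∀ᵐ μ ∂P, ∃ S : Set E3, InClass S ∧ μ = (Measure.count : Measure E3).restrict S) →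
      IsPointStationaryLaw P → meanRootEnergy P ≤ eStar →
      (∀ᵐ μ ∂P, ∀ y : E3, μ {y} ≠ 0 → CoarseGood (Measure.map (fun z => z - y) μ)) →
      ∀ᵐ μ ∂P, GoodShell μ := by
  sorry

/-! ## Composition: the five stub statements prove the crux BY NAME -/

/-- Two counting measures of sets agree only if the sets agree. [folklore] -/
theorem set_eq_of_count_restrict_eq {S S' : Set E3}
    (h : (Measure.count : Measure E3).restrict S = (Measure.count : Measure E3).restrict S') :
    S = S' := by
  ext y
  rw [← count_restrict_singleton_ne_zero_iff S y, ← count_restrict_singleton_ne_zero_iff S' y, h]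

/-- **The logic of the line, sorry-free**: the five stub STATEMENTS (as hypotheses, so that this
lemma's axiom closure is clean) imply the crux's folded form — a.s. `e*`-`μ`GSC (tree) ⇒ hard core
`17/20` (S1) ⇒ the class; (D), (S) and the exchange glue ⇒ coarse-good root a.s.; everything shows at
the root (tree) ⇒ every point coarse-good a.s.; fine endgame (S5). [folklore] -/
theorem minimiserShells_of_stubs
    (h1 : ∀ S : Set E3, UniformlyDiscrete S → IsMuGSC lennardJones eStar S →
      ∀ x ∈ S, ∀ y ∈ S, x ≠ y → (17 / 20 : ℝ) ≤ dist x y)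
    (h2 : ∃ c : ℝ, 0 < c ∧ ∃ t : Measure E3 → E3 → ℝ, IsTransfer t ∧ DensePricing c t)
    (h3 : ∃ c : ℝ, 0 < c ∧ ∃ t : Measure E3 → E3 → ℝ, IsTransfer t ∧ SparseSolvent c t)
    (h4 : UnimodularEnergyLowerBound →
      ∀ (cD cS : ℝ) (tD tS : Measure E3 → E3 → ℝ), 0 < cD → 0 < cS →
        IsTransfer tD → IsTransfer tS → DensePricing cD tD → SparseSolvent cS tS →
        ∀ P : Measure (Measure E3), IsProbabilityMeasure P →
          (∀ᵐ μ ∂P, ∃ S : Set E3, InClass S ∧ μ = (Measure.count : Measure E3).restrict S) →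
          IsPointStationaryLaw P → meanRootEnergy P ≤ eStar →
          ∀ᵐ μ ∂P, CoarseGood μ)
    (h5 : ∀ P : Measure (Measure E3), IsProbabilityMeasure P →
      (∀ᵐ μ ∂P, ∃ S : Set E3, InClass S ∧ μ = (Measure.count : Measure E3).restrict S) →
      IsPointStationaryLaw P → meanRootEnergy P ≤ eStar →
      (∀ᵐ μ ∂P, ∀ y : E3, μ {y} ≠ 0 → CoarseGood (Measure.map (fun z => z - y) μ)) →
      ∀ᵐ μ ∂P, GoodShell μ) :
    ∀ δ : ℝ, 0 < δ → ∀ P : Measure (Measure E3), IsProbabilityMeasure P →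
      (∀ᵐ μ ∂P, IsRootedHardCore δ μ) → IsPointStationaryLaw P → meanRootEnergy P ≤ eStar →
      ∀ᵐ μ ∂P, GoodShell μ := by
  intro δ hδ P hP hcore hstat hE
  -- the energy floor `e_uni ≥ e*` (item 9229) is in the tree
  have hU : UnimodularEnergyLowerBound :=
    Summit.AtomisticToContinuum.Crystallization.Theorems.PalmUnimodularRigidityMinimiserShells.EnergyFloor.stub_energyFloor
  -- FRAME (tree): almost surely the configuration is a Sütő `e*`-`μ`GSC
  have hgsc : ∀ᵐ μ ∂P, ∃ S : Set E3,
      μ = (Measure.count : Measure E3).restrict S ∧ IsMuGSC lennardJones eStar S :=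
    Summit.AtomisticToContinuum.Crystallization.Theorems.PalmUnimodularRigidityMinimiserShells.EquilibriumInLaw.stub_equilibriumInLaw
      hU δ hδ P hP hcore hstat hE
  -- S1: hence almost surely in the class (rooted, `17/20`-separated, `e*`-`μ`GSC)
  have hclass : ∀ᵐ μ ∂P, ∃ S : Set E3, InClass S ∧ μ = (Measure.count : Measure E3).restrict S := by
    filter_upwards [hcore, hgsc] with μ hc hg
    obtain ⟨S, h0, hsep, rfl⟩ := hc
    obtain ⟨S', hμ, hS'⟩ := hg
    obtain rfl : S = S' := set_eq_of_count_restrict_eq hμ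
    exact ⟨S, ⟨h0, h1 S ⟨δ, hδ, hsep⟩ hS', hS'⟩, rfl⟩
  -- S2, S3, S4: the root is coarse-good almost surely
  obtain ⟨cD, hcD, tD, htD, hD⟩ := h2
  obtain ⟨cS, hcS, tS, htS, hS⟩ := h3
  have hroot : ∀ᵐ μ ∂P, CoarseGood μ :=
    h4 hU cD cS tD tS hcD hcS htD htS hD hS P hP hclass hstat hE
  -- everything shows at the root (tree): every point is coarse-good almost surely
  have hlf : ∀ᵐ μ ∂P, ∀ n : ℕ, μ ((fun z : E3 => ⌊‖z‖⌋₊) ⁻¹' {n}) < ∞ := by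
    filter_upwards [hcore] with μ hμ n
    obtain ⟨S, -, hsep, rfl⟩ := hμ
    exact count_restrict_floorNorm_preimage_lt_top hδ hsep n
  have hall : ∀ᵐ μ ∂P, ∀ y : E3, μ {y} ≠ 0 → CoarseGood (Measure.map (fun z => z - y) μ) :=
    ae_forall_map_sub_of_ae hstat hlf hroot
  -- S5: the fine endgame
  exact h5 P hP hclass hstat hE hall

/-- **`MinimiserShells_of`** — the skeleton theorem: the crux
`Summit.AtomisticToContinuum.Crystallization.Theses.PalmUnimodularRigidity.MinimiserShells` BY NAME from
the five registered stubs `stub_muGSCHardCore`, `stub_denseSolvency`, `stub_sparseSolvency`,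
`stub_exchangeGlue`, `stub_fineEndgame` (the only declarations of this file containing `sorry`) through
the sorry-free `minimiserShells_of_stubs` and the definitional `minimiserShells_iff`. -/
theorem MinimiserShells_of : MinimiserShells :=
  minimiserShells_iff.2 (minimiserShells_of_stubs stub_muGSCHardCore stub_denseSolvency
    stub_sparseSolvency stub_exchangeGlue stub_fineEndgame)

end Summit.AtomisticToContinuum.Crystallization.Cruxes.MinimiserShells.DefectExchangeTwoResolutions

end
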